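import Summits.Ventures.CertifiedManyBodySolver.Observables.StiffnessApexTransportTargetSlot
import HarnessLib

/-!
# Ventures/CertifiedManyBodySolver — Observables/StiffnessApexTransportTargetSlotHighSlab.lean

HONEST FRAMING: one-sided certified CEILINGS on the uniform flux stiffness (`t–t′` f-sum class) at ANY density, transported into a HIGH `U`-slab
`[p, q] × [U₁, U_max]` from ONE station `U_A ≤ U₁` BELOW the slab, WITHOUT ANY `K₂` input; a ceiling never speaks to the presence of order; not a
`T_c` estimate, not a superconductivity verdict; every leaf is CONDITIONAL on the row families it names. Zero compute, no definition, no claim node,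
no `sorry`.

Cell `pub/hubbard-obs` (D-0154 (1)(C) COVERAGE NdNiO₂; captain hubbard-cov-ndnio2-plan-1 D8′ (3) «HighU BIRTH NOTE»: edition of record E-R = ONE station
`U_A = 5` for BOTH `U`-slabs of the residual cell), seat `hubbard-cov-ndnio2-box-2` (`prover-hubbard-cov-ndnio2-box-2-0`); a one-theorem sequel of
`Observables/StiffnessApexTransportTargetSlot.lean` §5 (`ObsStiffnessSeqCeilingAt_on_box_of_apexStation_twoEndObjectives`, seat hubbard-downfold-unc-2).
THE POINT. unc-2's two-END-objective station theorem words the box `[p, q] × [U_A, U_max]` from the station at its OWN bottom edge, sources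
`s ∈ [σ(2 − U_A/U_max), σ]`. A route that splits the `U`-range into slabs `[U_A, U₁] ∣ [U₁, U_max]` but reads BOTH from the one station `U_A` needs the
high slab served by the SHORTER source segment `s = t′(2 − U_A/U) ∈ [σ(2 − U_A/U_max), σ(2 − U_A/U₁)]` only (NdNiO₂: `U_A = 5`, `U₁ = 13/2`, `U_max = 17/2`:
`s ∈ [24σ/17, 16σ/13]`, i.e. `[−276/425, −0.5415…]` for `σ ∈ [−23/50, −11/25]`); this file states exactly that edition.

* `ObsStiffnessSeqCeilingAt_on_highSlab_of_apexStation_twoEndObjectives` — station `0 < U_A ≤ U₁ ≤ U_max`, targets `[p, q] × [U₁, U_max]` (`p < q ≤ 0`),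
  density `0 ≤ n < 2`; families `vP`, `vQ` for the END objectives `−X₀(p, U_A)`, `−X₀(q, U_A)` on the source segment `[p(2 − U_A/U_max), q(2 − U_A/U₁)]`,
  σ-chord price on `s ∈ [σ(2 − U_A/U_max), σ(2 − U_A/U₁)]` ⇒ the ceiling on the high slab.

References: T. Koma, H. Tasaki, J. Stat. Phys. 76 (1994) 745, §1 [KomaTasaki1994]; D. J. Scalapino, S. R. White, S.-C. Zhang, PRB 47 (1993)
7995, §II [ScalapinoWhiteZhang1993].
-/

noncomputable section

namespace Summit.Ventures.CertifiedManyBodySolver.Observables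

open Literature.MathematicalPhysics.QuantumLattice
open Literature.MathematicalPhysics.QuantumLattice.ThermodynamicLimit
open Literature.MathematicalPhysics.QuantumFieldTheory
open Literature.Probability.LatticeModels
open Matrix Finset Filter Topology HubbardWave0
open scoped Matrix BigOperators ComplexOrder

section HighSlab

variable {UA U₁ Umax p q n : ℝ}

/-- The source of a high-slab target lies on the SHORT segment: for `0 < U_A ≤ U₁ ≤ U ≤ U_max`, `t′ ∈ [p, q]`, `q ≤ 0`, the apex source
`s = t′(2U − U_A)/U` satisfies `t′(2 − U_A/U_max) ≤ s ≤ t′(2 − U_A/U₁)`, hence `s ∈ [p(2 − U_A/U_max), q(2 − U_A/U₁)]`. [folklore] -/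
theorem apexSource_mem_Icc_of_highSlab (hUA : 0 < UA) (hU₁ : UA ≤ U₁) {tp U : ℝ} (hU : U ∈ Set.Icc U₁ Umax) (hq : q ≤ 0)
    (htp : tp ∈ Set.Icc p q) :
    tp * (2 * U - UA) / U ∈ Set.Icc (tp * (2 - UA / Umax)) (tp * (2 - UA / U₁)) ∧
      tp * (2 * U - UA) / U ∈ Set.Icc (p * (2 - UA / Umax)) (q * (2 - UA / U₁)) := by
  have hU1pos : 0 < U₁ := hUA.trans_le hU₁
  have hUpos : 0 < U := hU1pos.trans_le hU.1
  have hUmaxpos : 0 < Umax := hUpos.trans_le hU.2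
  have htp0 : tp ≤ 0 := htp.2.trans hq
  have e : tp * (2 * U - UA) / U = tp * (2 - UA / U) := by
    field_simp
  rw [e]
  have hfU : 2 - UA / U ≤ 2 - UA / Umax := by
    have : UA / Umax ≤ UA / U := div_le_div_of_nonneg_left hUA.le hUpos hU.2
    linarith
  have hf1 : 2 - UA / U₁ ≤ 2 - UA / U := by
    have : UA / U ≤ UA / U₁ := div_le_div_of_nonneg_left hUA.le hU1pos hU.1
    linarith
  have hfmax0 : 0 ≤ 2 - UA / Umax := by
    have : UA / Umax ≤ 1 := (div_le_one hUmaxpos).2 (hU₁.trans (hU.1.trans hU.2))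
    linarith
  have hf10 : 0 ≤ 2 - UA / U₁ := by
    have : UA / U₁ ≤ 1 := (div_le_one hU1pos).2 hU₁
    linarith
  have h1 : tp * (2 - UA / Umax) ≤ tp * (2 - UA / U) := mul_le_mul_of_nonpos_left hfU htp0
  have h2 : tp * (2 - UA / U) ≤ tp * (2 - UA / U₁) := mul_le_mul_of_nonpos_left hf1 htp0
  refine ⟨⟨h1, h2⟩, ?_, ?_⟩
  · exact (mul_le_mul_of_nonneg_right htp.1 hfmax0).trans h1
  · exact h2.trans (mul_le_mul_of_nonneg_right htp.2 hf10)

/-- **THE HIGH SLAB FROM ONE LOWER STATION, two END objectives, NO `K₂` INPUT.** Station `0 < U_A ≤ U₁`, targets `(t′, U) ∈ [p, q] × [U₁, U_max]` with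
`p < q ≤ 0`, density `0 ≤ n < 2`. Two unconditional orbit-lower families on the SHORT station segment `s ∈ [p(2 − U_A/U_max), q(2 − U_A/U₁)]` (torus-limit
ground-state classes at `(s, U_A, n)`): `vP s` for the objective `−X₀(p, U_A)` and `vQ s` for `−X₀(q, U_A)`; price: for every target slot `σ ∈ [p, q]` and
source `s ∈ [σ(2 − U_A/U_max), σ(2 − U_A/U₁)]` the negated σ-CHORD `−((q − σ)vP s + (σ − p)vQ s)/(q − p) ≤ c`. Then `ObsStiffnessSeqCeilingAt t′ U n c` on
the whole high slab: the target `(t′, U)` is served by its apex source `s = t′(2 − U_A/U)` on the station, read at the target's own slot through the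
σ-chord of the two end objectives (`orbitLower_slot_chord_of_two_endObjectives`) and the point form
`ObsStiffnessSeqCeilingAt_of_apexSource_targetSlot_orbitLower`. With `U₁ = U_A` this is unc-2's `…_on_box_of_apexStation_twoEndObjectives`.
[cite: KomaTasaki1994, §1] [cite: ScalapinoWhiteZhang1993, §II] -/
theorem ObsStiffnessSeqCeilingAt_on_highSlab_of_apexStation_twoEndObjectives (hUA : 0 < UA) (hU₁ : UA ≤ U₁) (hq : q ≤ 0)
    (hpq : p < q) (hn0 : 0 ≤ n) (hn2 : n < 2) (vP vQ : ℝ → ℝ) (c : ℚ)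
    (hP : ∀ s ∈ Set.Icc (p * (2 - UA / Umax)) (q * (2 - UA / U₁)),
      ∀ (ω : InfVolFermionState 2) (Ls : ℕ → ℕ) (ψ : ∀ L, Fock (Orb (FermionTorus 2 L))),
      Tendsto Ls atTop atTop →
      (∀ j, IsGroundStateInSector (hubbardTorusTT' (Ls j) 1 s UA) (rectN n (Ls j)) 0 (ψ (Ls j))) →
      (∀ j, star (ψ (Ls j)) ⬝ᵥ ψ (Ls j) = 1) → ω.IsTorusLimitOf ψ Ls →
      vP s ≤ ((Finset.univ : Finset (DihedralGroup 4)).card : ℝ)⁻¹ * ∑ g ∈ (Finset.univ : Finset (DihedralGroup 4)),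
        (ω.expect (d4ShiftSet g 0 (box 2 7)) (fermionEmbed (PolySite.d4Emb g 0 (box 2 7)) (-oddMomentObsTT p UA 0))).re)
    (hQ : ∀ s ∈ Set.Icc (p * (2 - UA / Umax)) (q * (2 - UA / U₁)),
      ∀ (ω : InfVolFermionState 2) (Ls : ℕ → ℕ) (ψ : ∀ L, Fock (Orb (FermionTorus 2 L))),
      Tendsto Ls atTop atTop →
      (∀ j, IsGroundStateInSector (hubbardTorusTT' (Ls j) 1 s UA) (rectN n (Ls j)) 0 (ψ (Ls j))) →
      (∀ j, star (ψ (Ls j)) ⬝ᵥ ψ (Ls j) = 1) → ω.IsTorusLimitOf ψ Ls →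
      vQ s ≤ ((Finset.univ : Finset (DihedralGroup 4)).card : ℝ)⁻¹ * ∑ g ∈ (Finset.univ : Finset (DihedralGroup 4)),
        (ω.expect (d4ShiftSet g 0 (box 2 7)) (fermionEmbed (PolySite.d4Emb g 0 (box 2 7)) (-oddMomentObsTT q UA 0))).re)
    (hc : ∀ σ ∈ Set.Icc p q, ∀ s ∈ Set.Icc (σ * (2 - UA / Umax)) (σ * (2 - UA / U₁)),
      -((q - σ) / (q - p) * vP s + (σ - p) / (q - p) * vQ s) ≤ ((c : ℚ) : ℝ)) :
    ∀ tp ∈ Set.Icc p q, ∀ U ∈ Set.Icc U₁ Umax, ObsStiffnessSeqCeilingAt tp U n c := by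
  intro tp htp U hU
  have hUP : 0 < U := (hUA.trans_le hU₁).trans_le hU.1
  obtain ⟨hsσ, hseg⟩ := apexSource_mem_Icc_of_highSlab (Umax := Umax) hUA hU₁ hU hq htp
  have hapex : U * (tp * (2 * U - UA) / U) = (2 * U - UA) * tp := by
    rw [mul_div_assoc', mul_div_cancel_left₀ _ hUP.ne']; ring
  refine ObsStiffnessSeqCeilingAt_of_apexSource_targetSlot_orbitLower UA
    ((q - tp) / (q - p) * vP (tp * (2 * U - UA) / U) + (tp - p) / (q - p) * vQ (tp * (2 * U - UA) / U))
    hUA.le (hU₁.trans hU.1) hUP hapex hn0 hn2 (fun ω Ls ψ hLs hψ h1 hω => ?_) c (hc tp htp _ hsσ)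
  exact orbitLower_slot_chord_of_two_endObjectives hω.isTranslationInvariant UA hpq htp (hP _ hseg ω Ls ψ hLs hψ h1 hω)
    (hQ _ hseg ω Ls ψ hLs hψ h1 hω)

end HighSlab

end Summit.Ventures.CertifiedManyBodySolver.Observables

end
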